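import Mathlib.MeasureTheory.Constructions.Pi
import Mathlib.MeasureTheory.Integral.Prod
import Mathlib.MeasureTheory.Integral.Bochner.Set
import Mathlib.MeasureTheory.Measure.Lebesgue.Basic
import Mathlib.MeasureTheory.Integral.Bochner.Basic
import Mathlib.MeasureTheory.Constructions.BorelSpace.Basic
import HarnessLib

/-!
# FKG for MTP₂ (log-supermodular) densities on `ℝⁿ` with respect to a product measure
# (Karlin–Rinott 1980, Thm. 2.3 and Prop. 3.2; Preston 1974; Fortuin–Kasteleyn–Ginibre 1971)

Topic `Literature/Probability/LatticeModels` (cite item wi-39742; wanted by crux `LocalisationGHS` of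
`stmt-CriticalPhenomena-15882`, stubs `crossCoherence` / `outerCoherence` of `Lines/site-bayes.lean`,
`PlantedFKG` of the strategist sketch: positive association of the planted Gaussian-channel law
`ν_s(dy) ∝ e^{-|y|²/2s} Z_c(y) dy`, whose density is MTP₂).  The tree / Mathlib have FKG only on finite
distributive lattices (`four_functions_theorem`, `fkg`; `harris_fkg` for product measures on `{0,1}^E`);
this file vendors the continuous / mixed product-space version.

## What is printed (held text `paper:doi-10-1016-0047-259x-80-90065-2`)

§2 (p. 470): "Let `𝒳 = ∏ᵢ₌₁ⁿ 𝒳ᵢ` be a product of totally ordered spaces … endowed with the natural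
partial ordering … Let `σ = σ₁ × ⋯ × σ_n` denote a product measure on `𝒳` where `σᵢ` are σ-finite
measures on `𝒳ᵢ` … Whenever integrals or expectations appear, requirements of measurability and
integrability are tacitly assumed without further mention.  For `x, y ∈ 𝒳` define the lattice operations
`x ∨ y = (max(xᵢ, yᵢ))ᵢ`, `x ∧ y = (min(xᵢ, yᵢ))ᵢ`."  (1.4)/(1.6): `f` is **MTP₂** iff
`f(x ∨ y) f(x ∧ y) ≥ f(x) f(y)` for all `x, y`.  "A function `φ : 𝒳 → ℝ` is said to be increasing if
`x ≤ y` implies `φ(x) ≤ φ(y)`."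

> **Theorem 2.3** (Sarkar; Fortuin, Ginibre and Kasteleyn; Preston).  Let `f` be a probability density
> with respect to `dσ(x)` on `𝒳` satisfying `f(x ∨ y) f(x ∧ y) ≥ f(x) f(y)` for `x, y ∈ 𝒳`.  Then for
> any pair of increasing (or decreasing) functions `φ` and `ψ` on `𝒳` we have
> `∫ φ(x) ψ(x) f(x) dσ(x) ≥ (∫ φ(x) f(x) dσ(x)) (∫ ψ(x) f(x) dσ(x))`.  (2.12)

§4 (p. 486): "In probabilistic terms Theorem 2.3 can be expressed as … `E[φ(X)ψ(X)] ≥ E[φ(X)] E[ψ(X)]`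
for any pair of increasing (or decreasing) functions … Thus, existence of a MTP₂ density implies
association."  (1.15)/Prop. 3.2 (p. 468, p. 481): "if `X = (X₁, …, X_n)` is MTP₂, then any subset
… `(X₁, …, X_k)` is also MTP₂", i.e. the marginal densities of an MTP₂ density are MTP₂.

## Rendering (special case of the print)

* `𝒳ᵢ = ℝ` for every coordinate (the paper's §4 setting "MTP₂ joint density with respect to some product
  measure `σ = σ₁ × ⋯ × σ_n` on `ℝⁿ`"; mixed continuous/discrete coordinates are σ-finite measures on
  `ℝ`, e.g. Lebesgue and `δ_{-1} + δ_{1}`), finite index type `ι`, `Measure.pi μ`.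
* The tacit measurability/integrability requirements are made explicit and BOUNDEDNESS of `φ, ψ` is
  assumed (so that all three integrals exist) — hypotheses only added.
* Real-valued density `f ≥ 0` with `∫ f = 1`; `x ⊔ y`, `x ⊓ y` are the coordinatewise lattice
  operations of `ι → ℝ` and "increasing" is `Monotone` for the coordinatewise order.
* Marginals (Prop. 3.2): one coordinate at a time, `y ↦ ∫ f(x with t in slot i, y elsewhere) dμᵢ(t)`
  (`Fin.insertNth`), from which all sub-vector marginals follow by iteration.
* Conditioning ("MTP₂ is preserved under conditioning on coordinates") is, up to normalisation, the
  restriction to a section, and is PROVED (`IsMTP2.update`); so is closure under products (`IsMTP2.mul`,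
  Prop. 3.3's mechanism).

## Main statements

* `IsMTP2 f` (definition (1.4)) with `isMTP2_iff`, `isMTP2_const`, `IsMTP2.mul`, `IsMTP2.update` (proved).
* `KarlinRinott1980_thm_2_3` — NAMED FACT: FKG / positive association for MTP₂ densities.
* `KarlinRinott1980_thm_2_3.antitone` — proved corollary: the "(or decreasing)" clause.
* `KarlinRinott1980_prop_3_2` — NAMED FACT: one-coordinate marginals of MTP₂ densities are MTP₂.

## References

* S. Karlin, Y. Rinott, *Classes of orderings of measures and related correlation inequalities. I.
  Multivariate totally positive distributions*, J. Multivariate Anal. 10 (1980) 467–498, (1.4), §2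
  Thm. 2.3 (2.12), (1.15) and Prop. 3.2, §4 (association). [KarlinRinott1980]
* C. J. Preston, *A generalization of the FKG inequalities*, Comm. Math. Phys. 36 (1974) 233–241.
  [Preston1974]
* C. M. Fortuin, P. W. Kasteleyn, J. Ginibre, Comm. Math. Phys. 22 (1971) 89–103. [FortuinKasteleynGinibre1971]
-/

noncomputable section

open MeasureTheory

namespace Literature.Probability.LatticeModels

/-! ### MTP₂ kernels -/

/-- **Multivariate total positivity of order 2** (`MTP₂`, log-supermodularity) of a function on the
product lattice `ι → ℝ`: `f(x) f(y) ≤ f(x ∨ y) f(x ∧ y)` for all `x, y`, with the coordinatewise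
`max`/`min` (Karlin–Rinott (1.4)–(1.6)). [cite: KarlinRinott1980, (1.4)] -/
def IsMTP2 {ι : Type*} (f : (ι → ℝ) → ℝ) : Prop :=
  ∀ x y : ι → ℝ, f x * f y ≤ f (x ⊔ y) * f (x ⊓ y)

/-- Unfolding lemma. [folklore] -/
theorem isMTP2_iff {ι : Type*} (f : (ι → ℝ) → ℝ) :
    IsMTP2 f ↔ ∀ x y : ι → ℝ, f x * f y ≤ f (x ⊔ y) * f (x ⊓ y) := Iff.rfl

/-- Constants are MTP₂. [folklore] -/
theorem isMTP2_const {ι : Type*} (c : ℝ) : IsMTP2 (fun _ : ι → ℝ => c) := fun _ _ => le_rfl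

/-- **Products of nonnegative MTP₂ kernels are MTP₂** (the mechanism of Karlin–Rinott Prop. 3.3 and
Remark 2.1). [cite: KarlinRinott1980, §3 Prop. 3.3] -/
theorem IsMTP2.mul {ι : Type*} {f g : (ι → ℝ) → ℝ} (hf : IsMTP2 f) (hg : IsMTP2 g)
    (hf0 : ∀ x, 0 ≤ f x) (hg0 : ∀ x, 0 ≤ g x) : IsMTP2 (fun x => f x * g x) := by
  intro x y
  calc f x * g x * (f y * g y) = (f x * f y) * (g x * g y) := by ring
    _ ≤ (f (x ⊔ y) * f (x ⊓ y)) * (g (x ⊔ y) * g (x ⊓ y)) :=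
        mul_le_mul (hf x y) (hg x y) (mul_nonneg (hg0 x) (hg0 y))
          (mul_nonneg (hf0 _) (hf0 _))
    _ = f (x ⊔ y) * g (x ⊔ y) * (f (x ⊓ y) * g (x ⊓ y)) := by ring

/-- **Conditioning on a coordinate preserves MTP₂**: the section `x ↦ f(x with xᵢ := a)` of an MTP₂
kernel is MTP₂ (the conditional density given `Xᵢ = a` is this section divided by a constant).
[cite: KarlinRinott1980, §1 (1.6)] -/
theorem IsMTP2.update {ι : Type*} [DecidableEq ι] {f : (ι → ℝ) → ℝ} (hf : IsMTP2 f) (i : ι) (a : ℝ) :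
    IsMTP2 (fun x => f (Function.update x i a)) := by
  intro x y
  have hsup : Function.update (x ⊔ y) i a = Function.update x i a ⊔ Function.update y i a := by
    funext j
    by_cases h : j = i
    · subst h; simp
    · simp [Function.update_of_ne h]
  have hinf : Function.update (x ⊓ y) i a = Function.update x i a ⊓ Function.update y i a := by
    funext j
    by_cases h : j = i
    · subst h; simp
    · simp [Function.update_of_ne h]
  simp only [hsup, hinf]
  exact hf _ _

/-! ### The named facts -/

/-- **FKG / positive association for MTP₂ densities (Karlin–Rinott 1980, Thm. 2.3; Sarkar,
Fortuin–Kasteleyn–Ginibre, Preston 1974).**  Let `μ = ∏ᵢ μᵢ` be a product of σ-finite measures on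
`ℝ^ι` (`ι` finite) and `f ≥ 0` a measurable probability density with respect to `μ` which is MTP₂,
`f(x ∨ y) f(x ∧ y) ≥ f(x) f(y)`.  Then for every pair of bounded measurable coordinatewise
non-decreasing `φ, ψ : ℝ^ι → ℝ`,
`(∫ φ f dμ) (∫ ψ f dμ) ≤ ∫ φ ψ f dμ` — i.e. `E[φ(X) ψ(X)] ≥ E[φ(X)] E[ψ(X)]`: an MTP₂ random vector
is associated.  (Printed for products of totally ordered spaces with measurability/integrability tacit;
rendered on `ℝ^ι` with bounded `φ, ψ`.)  Named fact (D-0014); users take `(h : KarlinRinott1980_thm_2_3)`.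
[cite: KarlinRinott1980, Thm. 2.3 (2.12) and §4] [cite: Preston1974, §2 (main theorem; as cited in KarlinRinott1980 Thm. 2.3)] -/
def KarlinRinott1980_thm_2_3 : Prop :=
  ∀ (ι : Type) [Fintype ι] (μ : ι → Measure ℝ) [∀ i, SigmaFinite (μ i)] (f φ ψ : (ι → ℝ) → ℝ),
    Measurable f → (∀ x, 0 ≤ f x) → ∫ x, f x ∂Measure.pi μ = 1 → IsMTP2 f →
    Measurable φ → Measurable ψ → Monotone φ → Monotone ψ →
    (∃ C, ∀ x, |φ x| ≤ C) → (∃ C, ∀ x, |ψ x| ≤ C) →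
      (∫ x, φ x * f x ∂Measure.pi μ) * (∫ x, ψ x * f x ∂Measure.pi μ) ≤
        ∫ x, φ x * ψ x * f x ∂Measure.pi μ

/-- **The "(or decreasing)" clause of Thm. 2.3**, from the increasing one applied to `-φ, -ψ`.
[cite: KarlinRinott1980, Thm. 2.3] -/
theorem KarlinRinott1980_thm_2_3.antitone (h : KarlinRinott1980_thm_2_3) {ι : Type} [Fintype ι]
    (μ : ι → Measure ℝ) [∀ i, SigmaFinite (μ i)] {f φ ψ : (ι → ℝ) → ℝ}
    (hfm : Measurable f) (hf0 : ∀ x, 0 ≤ f x) (hf1 : ∫ x, f x ∂Measure.pi μ = 1) (hf : IsMTP2 f)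
    (hφm : Measurable φ) (hψm : Measurable ψ) (hφ : Antitone φ) (hψ : Antitone ψ)
    (hφb : ∃ C, ∀ x, |φ x| ≤ C) (hψb : ∃ C, ∀ x, |ψ x| ≤ C) :
    (∫ x, φ x * f x ∂Measure.pi μ) * (∫ x, ψ x * f x ∂Measure.pi μ) ≤
      ∫ x, φ x * ψ x * f x ∂Measure.pi μ := by
  obtain ⟨C, hC⟩ := hφb
  obtain ⟨D, hD⟩ := hψb
  have key := h ι μ f (fun x => -φ x) (fun x => -ψ x) hfm hf0 hf1 hf hφm.neg hψm.neg hφ.neg hψ.neg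
    ⟨C, fun x => by simpa using hC x⟩ ⟨D, fun x => by simpa using hD x⟩
  simp only [neg_mul, integral_neg, mul_neg, neg_neg] at key
  simpa using key

/-- **Marginals of MTP₂ densities are MTP₂ (Karlin–Rinott 1980, (1.15) and Prop. 3.2).**  Let
`μ = ∏ᵢ μᵢ` be a product of σ-finite measures on `ℝ^{n+1}` and `f ≥ 0` a measurable, integrable MTP₂
density.  Then for every coordinate `i` the marginal density obtained by integrating out `xᵢ`,
`y ↦ ∫ f(xᵢ := t, y) dμᵢ(t)` on `ℝⁿ` (`Fin.insertNth i t y`), is MTP₂.  ("If `X = (X₁, …, X_n)` is MTP₂,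
then any subset … is also MTP₂"; all sub-vector marginals follow by iteration.)  Named fact (D-0014).
[cite: KarlinRinott1980, (1.15) and Prop. 3.2] -/
def KarlinRinott1980_prop_3_2 : Prop :=
  ∀ (n : ℕ) (μ : Fin (n + 1) → Measure ℝ) [∀ i, SigmaFinite (μ i)] (f : (Fin (n + 1) → ℝ) → ℝ)
    (i : Fin (n + 1)),
    Measurable f → (∀ x, 0 ≤ f x) → Integrable f (Measure.pi μ) → IsMTP2 f →
      IsMTP2 fun y : Fin n → ℝ => ∫ t, f (Fin.insertNth i t y) ∂μ i

/-! ### Prop. 3.2: the rendering above is refutable as stated; the corrected (section-integrable) form is proved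

The named fact `KarlinRinott1980_prop_3_2` renders the marginal density with Lean's Bochner integral,
which returns the junk value `0` for a non-integrable section, and it only assumes integrability of `f`
on the product space — so a single non-integrable section (a null set of base points, invisible to the
integrability of `f`) can sit exactly at a join `y ⊔ z` and break the MTP₂ inequality of the marginal.
`not_KarlinRinott1980_prop_3_2` records such an `f` (the indicator of a `⊔/⊓`-closed Borel set
`S ⊆ ℝ³` of Lebesgue measure `1` whose section over the base point `(1,1)` is the half-line `[0,∞)`):
the rendering, not the printed proposition, is false.  The print's "requirements of measurability and
integrability are tacitly assumed" (§2, p. 470) is made explicit in `KarlinRinott1980_prop_3_2_of_integrable`: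
if every section `t ↦ f(xᵢ := t, y)` is integrable, the marginal IS MTP₂ — proved here by the
Ahlswede–Daykin/Karlin–Rinott `2 × 2` step (proof of Thm. 2.1, p. 471: "if `f₁, f₂, f₃, f₄` satisfy (2.1),
then the (marginals) … continue to satisfy (2.1)") and symmetrisation of the product integral; no
measurability of `f` on the product space is needed.  The finite-lattice form of Prop. 3.2 (push-forwards
of FKG weights along lattice homomorphisms) is `Literature.Combinatorics.Sahi2008.Marginals`.
-/

section PropThreeTwo

/-- The `2 × 2` step of Ahlswede–Daykin / Karlin–Rinott (proof of Thm. 2.1): for nonnegative reals with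
`ab ≤ AB`, `cd ≤ AB`, `ad ≤ AD`, `bc ≤ BC` one has `ab + cd ≤ AB + CD`. [cite: KarlinRinott1980, §2, proof of Thm. 2.1] -/
theorem two_by_two_step {a b c d A B C D : ℝ} (ha : 0 ≤ a) (hb : 0 ≤ b) (hc : 0 ≤ c) (hd : 0 ≤ d)
    (hA : 0 ≤ A) (hB : 0 ≤ B) (hC : 0 ≤ C) (hD : 0 ≤ D) (h₁ : a * b ≤ A * B) (h₂ : c * d ≤ A * B)
    (h₃ : a * d ≤ A * D) (h₄ : b * c ≤ B * C) : a * b + c * d ≤ A * B + C * D := by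
  rcases (mul_nonneg hA hB).eq_or_lt with h0 | hpos
  · have hab : a * b = 0 := le_antisymm (h0 ▸ h₁) (mul_nonneg ha hb)
    have hcd : c * d = 0 := le_antisymm (h0 ▸ h₂) (mul_nonneg hc hd)
    rw [hab, hcd, ← h0]
    simpa using mul_nonneg hC hD
  · have k₁ : 0 ≤ (A * B - a * b) * (A * B - c * d) := mul_nonneg (sub_nonneg.2 h₁) (sub_nonneg.2 h₂)
    have k₂ : (a * d) * (b * c) ≤ (A * D) * (B * C) :=
      mul_le_mul h₃ h₄ (mul_nonneg hb hc) (mul_nonneg hA hD)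
    have k₃ : A * B * (a * b + c * d) ≤ A * B * (A * B + C * D) := by nlinarith [k₁, k₂]
    exact le_of_mul_le_mul_left k₃ hpos

/-- `insertNth` commutes with the coordinatewise `⊔`. [folklore] -/
private theorem insertNth_sup_insertNth {n : ℕ} (i : Fin (n + 1)) (t s : ℝ) (y z : Fin n → ℝ) :
    (Fin.insertNth (α := fun _ => ℝ) i t y) ⊔ (Fin.insertNth (α := fun _ => ℝ) i s z) =
      Fin.insertNth (α := fun _ => ℝ) i (t ⊔ s) (y ⊔ z) := by
  have h := Fin.insertNth_binop (α := fun _ => ℝ) (fun _ a b => a ⊔ b) i t s y z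
  have e : (Fin.insertNth (α := fun _ => ℝ) i t y) ⊔ (Fin.insertNth (α := fun _ => ℝ) i s z) =
      fun j => (Fin.insertNth (α := fun _ => ℝ) i t y j) ⊔ (Fin.insertNth (α := fun _ => ℝ) i s z j) :=
    rfl
  rw [e, ← h]
  rfl

/-- `insertNth` commutes with the coordinatewise `⊓`. [folklore] -/
private theorem insertNth_inf_insertNth {n : ℕ} (i : Fin (n + 1)) (t s : ℝ) (y z : Fin n → ℝ) :
    (Fin.insertNth (α := fun _ => ℝ) i t y) ⊓ (Fin.insertNth (α := fun _ => ℝ) i s z) =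
      Fin.insertNth (α := fun _ => ℝ) i (t ⊓ s) (y ⊓ z) := by
  have h := Fin.insertNth_binop (α := fun _ => ℝ) (fun _ a b => a ⊓ b) i t s y z
  have e : (Fin.insertNth (α := fun _ => ℝ) i t y) ⊓ (Fin.insertNth (α := fun _ => ℝ) i s z) =
      fun j => (Fin.insertNth (α := fun _ => ℝ) i t y j) ⊓ (Fin.insertNth (α := fun _ => ℝ) i s z j) :=
    rfl
  rw [e, ← h]
  rfl

/-- The pointwise inequality behind Prop. 3.2: for an MTP₂ kernel `f ≥ 0`, base points `y, z` and heights
`t, s`, writing `F_y(t) = f(xᵢ := t, y)`,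
`F_y(t)F_z(s) + F_y(s)F_z(t) ≤ F_{y⊔z}(t)F_{y⊓z}(s) + F_{y⊔z}(s)F_{y⊓z}(t)`. [cite: KarlinRinott1980, §2, proof of Thm. 2.1 and Prop. 3.2] -/
theorem IsMTP2.symmetrised_section_le {n : ℕ} {f : (Fin (n + 1) → ℝ) → ℝ} (hf : IsMTP2 f)
    (hf0 : ∀ x, 0 ≤ f x) (i : Fin (n + 1)) (y z : Fin n → ℝ) (t s : ℝ) :
    f (Fin.insertNth i t y) * f (Fin.insertNth i s z) + f (Fin.insertNth i s y) * f (Fin.insertNth i t z) ≤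
      f (Fin.insertNth i t (y ⊔ z)) * f (Fin.insertNth i s (y ⊓ z)) +
        f (Fin.insertNth i s (y ⊔ z)) * f (Fin.insertNth i t (y ⊓ z)) := by
  -- it suffices to treat `s ≤ t`; the statement is symmetric in `(t, s)`
  wlog hst : s ≤ t generalizing t s
  · have h := this s t (le_of_not_ge hst)
    linarith [h]
  have ets : t ⊔ s = t := sup_eq_left.2 hst
  have est : s ⊔ t = t := sup_eq_right.2 hst
  have its : t ⊓ s = s := inf_eq_right.2 hst
  have ist : s ⊓ t = s := inf_eq_left.2 hst
  -- the four MTP₂ inputs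
  have h₁ := hf (Fin.insertNth i t y) (Fin.insertNth i s z)
  have h₂ := hf (Fin.insertNth i s y) (Fin.insertNth i t z)
  have h₃ := hf (Fin.insertNth i t y) (Fin.insertNth i t z)
  have h₄ := hf (Fin.insertNth i s z) (Fin.insertNth i s y)
  rw [insertNth_sup_insertNth, insertNth_inf_insertNth] at h₁ h₂ h₃ h₄
  rw [ets, its] at h₁
  rw [est, ist] at h₂
  rw [sup_idem, inf_idem] at h₃ h₄
  rw [sup_comm z y, inf_comm z y] at h₄
  exact two_by_two_step (hf0 _) (hf0 _) (hf0 _) (hf0 _) (hf0 _) (hf0 _) (hf0 _) (hf0 _) h₁ h₂ h₃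
    (by simpa [mul_comm] using h₄)

/-- **Karlin–Rinott 1980, (1.15)–(1.16) / Prop. 3.2, with the tacit integrability made explicit**
("if `X = (X₁,…,X_n)` is MTP₂, then any subset … is also MTP₂"): if `f ≥ 0` is MTP₂ on `ℝ^{n+1}` and
EVERY section `t ↦ f(xᵢ := t, y)` is integrable for the σ-finite measure `μᵢ`, then the marginal
`y ↦ ∫ f(xᵢ := t, y) dμᵢ(t)` is MTP₂ on `ℝⁿ`.  (Product σ-finite base measures on the other coordinates
play no role for one marginalisation step; all sub-vector marginals follow by iteration.)  Proof: the
symmetrised double integral of `IsMTP2.symmetrised_section_le` over `μᵢ ⊗ μᵢ`.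
[cite: KarlinRinott1980, (1.15)–(1.16) and Prop. 3.2] -/
theorem KarlinRinott1980_prop_3_2_of_integrable {n : ℕ} (ν : Measure ℝ) [SigmaFinite ν]
    {f : (Fin (n + 1) → ℝ) → ℝ} (i : Fin (n + 1)) (hf0 : ∀ x, 0 ≤ f x) (hf : IsMTP2 f)
    (hint : ∀ y : Fin n → ℝ, Integrable (fun t => f (Fin.insertNth i t y)) ν) :
    IsMTP2 fun y : Fin n → ℝ => ∫ t, f (Fin.insertNth i t y) ∂ν := by
  intro y z
  set F : (Fin n → ℝ) → ℝ → ℝ := fun w t => f (Fin.insertNth i t w) with hF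
  change (∫ t, F y t ∂ν) * (∫ t, F z t ∂ν) ≤ (∫ t, F (y ⊔ z) t ∂ν) * (∫ t, F (y ⊓ z) t ∂ν)
  -- both sides as halves of symmetrised product integrals
  have hprod : ∀ u w : Fin n → ℝ,
      (∫ t, F u t ∂ν) * (∫ t, F w t ∂ν) = ∫ p : ℝ × ℝ, F u p.1 * F w p.2 ∂ν.prod ν :=
    fun u w => (integral_prod_mul (F u) (F w)).symm
  have hswap : ∀ u w : Fin n → ℝ,
      ∫ p : ℝ × ℝ, F u p.2 * F w p.1 ∂ν.prod ν = ∫ p : ℝ × ℝ, F u p.1 * F w p.2 ∂ν.prod ν := by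
    intro u w
    have := integral_prod_swap (μ := ν) (ν := ν) (fun p : ℝ × ℝ => F u p.1 * F w p.2)
    simpa using this
  have hint2 : ∀ u w : Fin n → ℝ, Integrable (fun p : ℝ × ℝ => F u p.1 * F w p.2) (ν.prod ν) :=
    fun u w => (hint u).mul_prod (hint w)
  have hint2' : ∀ u w : Fin n → ℝ, Integrable (fun p : ℝ × ℝ => F u p.2 * F w p.1) (ν.prod ν) := by
    intro u w
    have h := (hint2 w u)
    refine h.congr ?_
    exact Filter.Eventually.of_forall fun p => mul_comm _ _
  have lhs : 2 * ((∫ t, F y t ∂ν) * (∫ t, F z t ∂ν)) =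
      ∫ p : ℝ × ℝ, (F y p.1 * F z p.2 + F y p.2 * F z p.1) ∂ν.prod ν := by
    rw [integral_add (hint2 y z) (hint2' y z), hswap, ← hprod, two_mul]
  have rhs : 2 * ((∫ t, F (y ⊔ z) t ∂ν) * (∫ t, F (y ⊓ z) t ∂ν)) =
      ∫ p : ℝ × ℝ, (F (y ⊔ z) p.1 * F (y ⊓ z) p.2 + F (y ⊔ z) p.2 * F (y ⊓ z) p.1) ∂ν.prod ν := by
    rw [integral_add (hint2 _ _) (hint2' _ _), hswap, ← hprod, two_mul]
  have hmono : ∫ p : ℝ × ℝ, (F y p.1 * F z p.2 + F y p.2 * F z p.1) ∂ν.prod ν ≤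
      ∫ p : ℝ × ℝ, (F (y ⊔ z) p.1 * F (y ⊓ z) p.2 + F (y ⊔ z) p.2 * F (y ⊓ z) p.1) ∂ν.prod ν :=
    integral_mono ((hint2 y z).add (hint2' y z)) ((hint2 _ _).add (hint2' _ _)) fun p =>
      hf.symmetrised_section_le hf0 i y z p.1 p.2
  linarith [lhs, rhs, hmono]

/-! #### The counterexample to the junk-valued rendering -/

namespace PropThreeTwoCounterexample

open Set

/-- The `⊔/⊓`-closed Borel set `S ⊆ ℝ³`: `0 ≤ x₀`, `x₁, x₂ ∈ [0,1]`, and `x₀ ≤ 1` unless `(x₁,x₂) = (1,1)`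
(over the single base point `(1,1)` the section is the half-line `[0,∞)`). [folklore] -/
private def S : Set (Fin 3 → ℝ) :=
  {x | 0 ≤ x 0 ∧ x 1 ∈ Icc (0 : ℝ) 1 ∧ x 2 ∈ Icc (0 : ℝ) 1 ∧ (x 0 ≤ 1 ∨ (x 1 = 1 ∧ x 2 = 1))}

/-- The kernel of the counterexample: the indicator of `S`. [folklore] -/
private def f : (Fin 3 → ℝ) → ℝ := S.indicator 1

/-- `S` is Borel. [folklore] -/
private theorem measurableSet_S : MeasurableSet S := by
  have h0 : Measurable fun x : Fin 3 → ℝ => x 0 := measurable_pi_apply 0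
  have h1 : Measurable fun x : Fin 3 → ℝ => x 1 := measurable_pi_apply 1
  have h2 : Measurable fun x : Fin 3 → ℝ => x 2 := measurable_pi_apply 2
  have e : S = {x | 0 ≤ x 0} ∩ ((fun x : Fin 3 → ℝ => x 1) ⁻¹' Icc 0 1) ∩
      ((fun x : Fin 3 → ℝ => x 2) ⁻¹' Icc 0 1) ∩ ({x | x 0 ≤ 1} ∪ ({x | x 1 = 1} ∩ {x | x 2 = 1})) := by
    ext x; simp [S, and_assoc]
  rw [e]
  refine ((measurableSet_le measurable_const h0).inter (h1 measurableSet_Icc)).inter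
    (h2 measurableSet_Icc) |>.inter ?_
  exact (measurableSet_le h0 measurable_const).union
    ((measurableSet_eq_fun h1 measurable_const).inter (measurableSet_eq_fun h2 measurable_const))

/-- `f ≥ 0`. [folklore] -/
private theorem f_nonneg (x : Fin 3 → ℝ) : 0 ≤ f x :=
  Set.indicator_nonneg (fun _ _ => zero_le_one) x

/-- `f` is measurable. [folklore] -/
private theorem measurable_f : Measurable f :=
  measurable_one.indicator measurableSet_S

/-- `S` is closed under `⊔`. [folklore] -/
private theorem sup_mem_S {x y : Fin 3 → ℝ} (hx : x ∈ S) (hy : y ∈ S) : x ⊔ y ∈ S := by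
  rcases hx with ⟨hx0, ⟨hx1a, hx1b⟩, ⟨hx2a, hx2b⟩, hx3⟩
  rcases hy with ⟨hy0, ⟨hy1a, hy1b⟩, ⟨hy2a, hy2b⟩, hy3⟩
  simp only [S, mem_setOf_eq, Pi.sup_apply, mem_Icc]
  refine ⟨le_sup_of_le_left hx0, ⟨le_sup_of_le_left hx1a, sup_le hx1b hy1b⟩,
    ⟨le_sup_of_le_left hx2a, sup_le hx2b hy2b⟩, ?_⟩
  rcases hx3 with hx3 | ⟨hx31, hx32⟩
  · rcases hy3 with hy3 | ⟨hy31, hy32⟩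
    · exact Or.inl (sup_le hx3 hy3)
    · right
      rw [hy31, hy32]
      exact ⟨le_antisymm (sup_le hx1b le_rfl) le_sup_right, le_antisymm (sup_le hx2b le_rfl) le_sup_right⟩
  · right
    rw [hx31, hx32]
    exact ⟨le_antisymm (sup_le le_rfl hy1b) le_sup_left, le_antisymm (sup_le le_rfl hy2b) le_sup_left⟩

/-- `S` is closed under `⊓`. [folklore] -/
private theorem inf_mem_S {x y : Fin 3 → ℝ} (hx : x ∈ S) (hy : y ∈ S) : x ⊓ y ∈ S := by
  rcases hx with ⟨hx0, ⟨hx1a, hx1b⟩, ⟨hx2a, hx2b⟩, hx3⟩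
  rcases hy with ⟨hy0, ⟨hy1a, hy1b⟩, ⟨hy2a, hy2b⟩, hy3⟩
  simp only [S, mem_setOf_eq, Pi.inf_apply, mem_Icc]
  refine ⟨le_inf hx0 hy0, ⟨le_inf hx1a hy1a, inf_le_of_left_le hx1b⟩,
    ⟨le_inf hx2a hy2a, inf_le_of_left_le hx2b⟩, ?_⟩
  rcases hx3 with hx3 | ⟨hx31, hx32⟩
  · exact Or.inl (inf_le_of_left_le hx3)
  · rcases hy3 with hy3 | ⟨hy31, hy32⟩
    · exact Or.inl (inf_le_of_right_le hy3)
    · right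
      rw [hx31, hx32, hy31, hy32]
      exact ⟨inf_idem _, inf_idem _⟩

/-- The indicator of the `⊔/⊓`-closed set `S` is MTP₂. [folklore] -/
private theorem isMTP2_f : IsMTP2 f := by
  intro x y
  by_cases hx : x ∈ S
  · by_cases hy : y ∈ S
    · simp [f, indicator_of_mem, hx, hy, sup_mem_S hx hy, inf_mem_S hx hy]
    · simp only [f, indicator_of_notMem hy, mul_zero]
      exact mul_nonneg (f_nonneg _) (f_nonneg _)
  · simp only [f, indicator_of_notMem hx, zero_mul]
    exact mul_nonneg (f_nonneg _) (f_nonneg _)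

/-- `S` sits inside the unit cube union the hyperplane `{x₁ = 1}`. [folklore] -/
private theorem S_subset : S ⊆ Set.pi univ (fun _ : Fin 3 => Icc (0 : ℝ) 1) ∪ {x | x 1 = 1} := by
  rintro x ⟨hx0, hx1, hx2, hx3 | ⟨hx31, _⟩⟩
  · left
    simp only [mem_pi, mem_univ, true_implies]
    intro j
    fin_cases j
    · exact ⟨hx0, hx3⟩
    · exact hx1
    · exact hx2
  · exact Or.inr hx31

/-- `S` has finite Lebesgue measure (at most `1`). [folklore] -/
private theorem volume_S_ne_top : (Measure.pi fun _ : Fin 3 => (volume : Measure ℝ)) S ≠ ⊤ := by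
  refine ne_top_of_le_ne_top ?_ (measure_mono S_subset)
  refine ne_of_lt (lt_of_le_of_lt (measure_union_le _ _) ?_)
  rw [Measure.pi_pi, Measure.pi_hyperplane (fun _ : Fin 3 => (volume : Measure ℝ)) 1 (1 : ℝ), add_zero]
  simp [Real.volume_Icc]

/-- `f` is integrable for Lebesgue measure on `ℝ³`. [folklore] -/
private theorem integrable_f : Integrable f (Measure.pi fun _ : Fin 3 => (volume : Measure ℝ)) := by
  rw [f, integrable_indicator_iff measurableSet_S]
  exact integrableOn_const volume_S_ne_top

/-- Coordinates of `Fin.insertNth 0 t y` on `Fin 3`. [folklore] -/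
private theorem ins_apply (t : ℝ) (y : Fin 2 → ℝ) :
    Fin.insertNth (α := fun _ => ℝ) (0 : Fin 3) t y 0 = t ∧
      Fin.insertNth (α := fun _ => ℝ) (0 : Fin 3) t y 1 = y 0 ∧
        Fin.insertNth (α := fun _ => ℝ) (0 : Fin 3) t y 2 = y 1 := by
  refine ⟨Fin.insertNth_apply_same _ _ _, ?_, ?_⟩
  · exact Fin.insertNth_apply_succAbove (α := fun _ => ℝ) (0 : Fin 3) t y 0
  · exact Fin.insertNth_apply_succAbove (α := fun _ => ℝ) (0 : Fin 3) t y 1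

/-- The section of `f` over a base point `y` with `y 0, y 1 ∈ [0,1]`, as an indicator in `t`. [folklore] -/
private theorem f_ins_eq (y : Fin 2 → ℝ) (hy0 : y 0 ∈ Icc (0 : ℝ) 1) (hy1 : y 1 ∈ Icc (0 : ℝ) 1) (t : ℝ) :
    f (Fin.insertNth 0 t y) = ({t : ℝ | 0 ≤ t ∧ (t ≤ 1 ∨ (y 0 = 1 ∧ y 1 = 1))}).indicator 1 t := by
  obtain ⟨e0, e1, e2⟩ := ins_apply t y
  simp only [f, indicator_apply, S, mem_setOf_eq, e0, e1, e2, hy0, hy1, true_and, Pi.one_apply]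

/-- Over a base point of `[0,1]²` other than `(1,1)` the section is `[0,1]`: marginal value `1`. [folklore] -/
private theorem section_good (y : Fin 2 → ℝ) (hy0 : y 0 ∈ Icc (0 : ℝ) 1) (hy1 : y 1 ∈ Icc (0 : ℝ) 1)
    (h : ¬ (y 0 = 1 ∧ y 1 = 1)) :
    ∫ t, f (Fin.insertNth 0 t y) = 1 := by
  have e : (fun t => f (Fin.insertNth 0 t y)) = (Icc (0 : ℝ) 1).indicator 1 := by
    funext t
    rw [f_ins_eq y hy0 hy1]
    congr 1
    ext s
    simp [h, mem_Icc]
  rw [e, integral_indicator_one measurableSet_Icc, Measure.real, Real.volume_Icc]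
  simp

/-- Over `(1,1)` the section is `[0,∞)`: non-integrable, Bochner junk value `0`. [folklore] -/
private theorem section_bad (y : Fin 2 → ℝ) (hy0 : y 0 = 1) (hy1 : y 1 = 1) :
    ∫ t, f (Fin.insertNth 0 t y) = 0 := by
  have e : (fun t => f (Fin.insertNth 0 t y)) = (Ici (0 : ℝ)).indicator 1 := by
    funext t
    rw [f_ins_eq y (by rw [hy0]; exact ⟨zero_le_one, le_rfl⟩) (by rw [hy1]; exact ⟨zero_le_one, le_rfl⟩)]
    congr 1
    ext s
    simp [hy0, hy1, mem_Ici]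
  rw [e, integral_indicator_one measurableSet_Ici, Measure.real, Real.volume_Ici]
  simp

end PropThreeTwoCounterexample

open PropThreeTwoCounterexample in
/-- **The junk-valued rendering `KarlinRinott1980_prop_3_2` is false.**  Witness: `n = 2`, Lebesgue
measure on each coordinate, `i = 0`, `f = 1_S` with `S` the `⊔/⊓`-closed Borel set of
`PropThreeTwoCounterexample.S` (measurable, `0 ≤ f`, integrable — `S` has measure `≤ 1` — and MTP₂);
its sections over `(1,0)`, `(0,1)` are `[0,1]` (marginal value `1`) but over `(1,0) ⊔ (0,1) = (1,1)` the
section is `[0,∞)`, non-integrable, so the Bochner marginal is the junk value `0` and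
`1 · 1 ≤ 0 · (marginal at (0,0))` fails.  The printed proposition (with its tacit integrability) is
`KarlinRinott1980_prop_3_2_of_integrable`. [cite: KarlinRinott1980, (1.15)–(1.16) and Prop. 3.2; §2 p. 470 (tacit integrability)] -/
theorem not_KarlinRinott1980_prop_3_2 : ¬ KarlinRinott1980_prop_3_2 := by
  intro h
  have hm := h 2 (fun _ => volume) f 0 measurable_f f_nonneg integrable_f isMTP2_f ![1, 0] ![0, 1]
  have hsup : (![1, 0] : Fin 2 → ℝ) ⊔ ![0, 1] = ![1, 1] := by
    funext j; fin_cases j <;> simp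
  have hinf : (![1, 0] : Fin 2 → ℝ) ⊓ ![0, 1] = ![0, 0] := by
    funext j; fin_cases j <;> simp
  rw [hsup, hinf] at hm
  have g1 : ∫ t, f (Fin.insertNth 0 t ![1, 0]) = 1 :=
    section_good _ (by simp) (by simp) (by simp)
  have g2 : ∫ t, f (Fin.insertNth 0 t ![0, 1]) = 1 :=
    section_good _ (by simp) (by simp) (by simp)
  have g3 : ∫ t, f (Fin.insertNth 0 t ![1, 1]) = 0 := section_bad _ (by simp) (by simp)
  simp only [g1, g2, g3, mul_one, zero_mul] at hm
  exact absurd hm (by norm_num)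

end PropThreeTwo

end Literature.Probability.LatticeModels

end
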